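import Summits.QuantumFields.BalabanUV.T4Continuum.Support.VariationalColourTaxiTowerProjG
import Summits.QuantumFields.BalabanUV.T4Continuum.Support.DivControlCovariantFrames

/-!
# T⁴ programme, spine node NE2 (U1a), lane P2 — «V-COL-TAXI-END» part 7: THE CAPSTONE's COERCIVITY BINDER (GF3) DISCHARGED IN THE REGULAR CLASS —
# EXISTENCE of the vector tower limit at Bałaban's taxi data for Bałaban's COVARIANT projected gauge functional `projG (Rlev k) (ker Q_{taxi,k})`
# ⇐ (ONE-min) + a REGULAR PRESENTATION of the tower's unit-lattice bond fields (`‖Rlev k − 1‖ ≤ a_k`, `‖Rlev k(x,μ) − Rlev k(x−e_μ,μ)‖ ≤ ℓ_k`,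
# `L^k·a_k ≤ α`, `(L^k)²·ℓ_k ≤ λ`) + numeric smallness in `(d, α, λ, c)` (model level, `E = ℂ`)

NE2 formalisation swarm `b2b-balaban-t4-ne2-formalise-*`, leaf prover 04 GEN 6 (`prover-b2b-balaban-t4-ne2-formalise-leaf-04-g6-0`); journal INTENT
CLAIMS.log l.19466 «THE CAPSTONE's `hGdiv` DISCHARGED IN THE REGULAR CLASS».  On top of part 6 `VariationalColourTaxiTowerProjG.effV_tendsto_taxiTower_projG_of_class`
(gen 5, p229644: EXISTENCE ⇐ (GF3)_k + (ONE-min)_k), this seat's «(GF3) WITH BACKGROUND FOR COVARIANT FRAMES» (`SliceComplementFlatGap.sliceFlat_close_covariant`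
p231185, `DivControlOfSliceClose.divControl_of_sliceClose` p231292, `DivControlCovariantFrames.{nsqV_QvL_flat_le_of_near, norm_lineT_sub_one_le}` p231645), the
lineage's (E_k) `nestLv_sub_lineT_le` (gen 4 part 9), `sumDefect_le_of_class` ∕ `blockDefect_le_of_class` ∕ `taxiClassPackage` (gen 5 parts 2 ∕ 4),
`inBlock_defect_taxiTv_adjoint_le` ∕ `inBlock_blockOf_of_bpt` ∕ `taxiTv_mem_unitary` ∕ `Rlev_mem_unitary` and leaf-03-g6's `RegularGaugePerturbation.norm_piTv_sub_one_le`
— BY NAME.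

THE STATEMENTS.
 * §1 `norm_legTv_sub_one_le`, `norm_taxiAcc_sub_one_le`, **`norm_taxiTv_sub_one_le`**: contractive bonds with `‖R − 1‖ ≤ a` (`0 ≤ a`) have taxi frames
   `‖taxiTv R x − 1‖ ≤ d·(L·a)` (a product of `d` legs of `≤ L − 1` bonds).
 * §2 **`deltaGap_le_of_class`**: the gap constant is monotone in its classes — `na ≤ α`, `n²ℓ ≤ λ`, `τ ≤ τ⋆`, `nw ≤ ω` (all `≥ 0`) ⟹
   `deltaGap d n a ℓ τ w ≤ deltaGap d 1 α λ τ⋆ ω` (`deltaGap d 1 · · · ·` IS the class form: `revPC d 1 ω = 4d·36^d(1+ω)²`).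
 * §3 **`hGdiv_projG_nestLv_regular`**: part 6's displayed binder `hGdiv k` for `G k := projG (Rlev k) (ker Q_{taxiTv (Rlev k)})`, `Q := QvL (nestLv k)`, at ONE
   level `n = L^k`, from: a regular presentation `(a, ℓ)` of `Rlev k` with `na ≤ α`, `n²ℓ ≤ λ`; the plaquette bound `p` of `Rlev k` with `n²p ≤ c` (mismatch
   `w = (d−1)(n−1)p`, `nw ≤ (d−1)c`); the (E_k) defect `γ ≤ 2((d−1)+d²)c` of the nested carriers; numeric smallness
   `(18C_f + 6)·(deltaGap d 1 α λ (d·α) ((d−1)c))² ≤ ½`, `C_B·(7dα² + 2(2((d−1)+d²)c + (d+1)α)²) ≤ ½`; constants `C_D = 36C_f + 8`, `C_D′ = 24C_f + 4`.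
 * §4 **`effV_tendsto_taxiTower_projG_regular_of_class`** = part 6 with (GF3)_k SUPPLIED at every level: hypotheses = part 6's one-step data (unitary, plaquette
   class `(L^{k+1})²b_k ≤ c`, coherent), its polynomial smallness `hsm1–hsm4`, the DISPLAYED regular presentation `(a_k, ℓ_k)` of `Rlev k` with the classes
   `L^k·a_k ≤ α`, `(L^k)²·ℓ_k ≤ λ`, the two numeric lines above, and (ONE-min)_k — conclusion verbatim part 6's (existence of `lim effV`, Hermitian PSD limit,
   convergence of every block-spin value).
NOT HERE: (ONE-min) with background (leaf-01-g8 ∕ leaf-10 lineage); any gauge fixing producing the regular presentation; the rate.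

HONEST FRAMING (T4-DAG p. 1).  Rung (B)+1 only — NOT infinite volume, NOT a mass gap, NOT Clay.  NE2 NOT IN PRINT, NOT proved here.  MODEL LEVEL (`E = ℂ`; bond
operators DATA; taxi ∕ straight contours and the straight-taxi slice subspace OURS; [B9] (3.10)∕(3.15)∕(3.19), [B5] (1.69)–(1.70) SHAPES only; no B0, c5).  The
regular presentation of `Rlev k` is a HYPOTHESIS on the data (no gauge transformation is performed and the gauge covariance of the forms is not proved); the
numeric thresholds inherit pv15's `γ₀` (inside `C_f = d(d+1)Cst(d,1)`, `Cst(2,1) ≈ 1.28·10¹²` by leaf-10-g3's float evaluation, CLAIMS.log l.18447) and `revPC`'s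
`4d·36^d`: at `d = 2` they read `α ≲ 7·10⁻¹³`, `λ ≲ 4·10⁻⁹`, `c ≲ 3·10⁻⁸` (v1 said «α ≲ 10⁻⁶»: ERRATUM, v1.1) — n-UNIFORM and genuine, but QUANTITATIVELY VOID like the road's
other kernel constants; NOT optimised.  OURS, [folklore]; nothing printed is a hypothesis;
no `def`, no `def … : Prop`, no `sorry`; axioms standard.  V-END with background NOT proved ((ONE-min) displayed); NE2 NOT proved on either road; NE3 OPEN; spine
PROVED 0∕9.  HONEST DEPENDENCY (cell, verbatim): continuum YM on T⁴ ⇐ BetaPertH ∧ nine spine estimates (0/9 proved); BetaPertH ⇐ (D1) ∧ (D4) ∧ CAP+tail;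
G-an2-4 gates asym, D1 and NE2/3/4.
-/

noncomputable section

namespace Summit.QuantumFields.BalabanUV.T4Continuum.VariationalColourTaxiTransport

open Finset Filter
open scoped Matrix ComplexOrder BigOperators Topology
open Literature.MathematicalPhysics.QuantumFieldTheory.Balaban1983to89.B5Prop11Plancherel (Tor fine unitVec Cst)
open Literature.MathematicalPhysics.QuantumFieldTheory.Balaban1983to89.B5Block118 (bpt)
open Literature.MathematicalPhysics.QuantumFieldTheory.Balaban1983to89.B5Blocks16 (blockOf)
open Literature.Analysis.Complex (qform)
open Summit.QuantumFields.BalabanUV.T4Continuum.VariationalTransfer (blockSpin)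
open Summit.QuantumFields.BalabanUV.T4Continuum.VariationalColourFederbush (norm_le_one_of_mem_unitary piTv norm_piTv_le_one)
open Summit.QuantumFields.BalabanUV.T4Continuum.VariationalColourTower (Rtrv)
open Summit.QuantumFields.BalabanUV.T4Continuum.VariationalVectorFederbush (lineT)
open Summit.QuantumFields.BalabanUV.T4Continuum.VectorBlockTrialForm (nsqV nsqV_nonneg QvL roughV kappaV)
open Summit.QuantumFields.BalabanUV.T4Continuum.VariationalVectorForm (ScV SfV qWV lamV lamV_nonneg ScV_nonneg qWV_nonneg)
open Summit.QuantumFields.BalabanUV.T4Continuum.VariationalVectorEffective (unc effV)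
open Summit.QuantumFields.BalabanUV.T4Continuum.VariationalVectorTower (Gtr QmL)
open Summit.QuantumFields.BalabanUV.T4Continuum.VariationalVectorWeitzenbock (divSq)
open Summit.QuantumFields.BalabanUV.T4Continuum.VariationalVectorGaugeSlice (avgOp projG projG_nonneg)
open Summit.QuantumFields.BalabanUV.T4Continuum.VariationalVectorOneStepPhys (rhoV)
open Summit.QuantumFields.BalabanUV.T4Continuum.VariationalVectorRegularityCovariant (GmProj)
open Summit.QuantumFields.BalabanUV.T4Continuum.CovariantBlockReversePoincare (revPC revPC_nonneg)
open Summit.QuantumFields.BalabanUV.T4Continuum.RegularGaugePerturbation (norm_piTv_sub_one_le)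
open Summit.QuantumFields.BalabanUV.T4Continuum.SliceComplementFlatGap (gapE gapE_nonneg deltaGap deltaGap_nonneg sliceFlat_close_covariant)
open Summit.QuantumFields.BalabanUV.T4Continuum.DivControlOfSliceClose (divControl_of_sliceClose)
open Summit.QuantumFields.BalabanUV.T4Continuum.DivControlCovariantFrames (nsqV_QvL_flat_le_of_near norm_lineT_sub_one_le)

variable {d : ℕ}

/-! ## §1 Taxi frames of a regular bond field are close to the identity -/

section TaxiNear

variable {E : Type*} [NormedAddCommGroup E] [NormedSpace ℂ E]
variable (L : ℕ) [NeZero L] (N : Fin d → ℕ) [hN : ∀ μ, NeZero (N μ)]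
variable {R' : Tor (fine L N) → Fin d → (E →L[ℂ] E)} (hR' : ∀ x μ, ‖R' x μ‖ ≤ 1) {a : ℝ} (ha0 : 0 ≤ a) (ha : ∀ x μ, ‖R' x μ - 1‖ ≤ a)
include hR' ha0 ha

omit hN in
/-- each taxi leg (`≤ L − 1` bonds) is within `L·a` of the identity. [folklore] -/
theorem norm_legTv_sub_one_le (y : Tor N) (j : Fin d → Fin L) (i : ℕ) : ‖legTv L N R' y j i - 1‖ ≤ L * a := by
  unfold legTv
  split_ifs with h
  · exact (norm_piTv_sub_one_le L N hR' ha _ _ _).trans (mul_le_mul_of_nonneg_right (by exact_mod_cast (j ⟨i, h⟩).is_lt.le) ha0)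
  · rw [sub_self, norm_zero]; positivity

omit hN in
/-- the accumulated taxi transport of `i` legs is within `i·(L·a)` of the identity. [folklore] -/
theorem norm_taxiAcc_sub_one_le (y : Tor N) (j : Fin d → Fin L) (i : ℕ) : ‖taxiAcc L N R' y j i - 1‖ ≤ i * (L * a) := by
  induction i with
  | zero => simp [taxiAcc]
  | succ i ih =>
    simp only [taxiAcc]
    have hleg := norm_legTv_sub_one_le L N hR' ha0 ha y j i
    have hleg1 := norm_legTv_le_one L N hR' y j i
    calc ‖taxiAcc L N R' y j i * legTv L N R' y j i - 1‖
        = ‖(taxiAcc L N R' y j i - 1) * legTv L N R' y j i + (legTv L N R' y j i - 1)‖ := by congr 1; rw [sub_mul, one_mul]; abel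
      _ ≤ ‖taxiAcc L N R' y j i - 1‖ * ‖legTv L N R' y j i‖ + ‖legTv L N R' y j i - 1‖ :=
          (norm_add_le _ _).trans (add_le_add (norm_mul_le _ _) le_rfl)
      _ ≤ i * (L * a) * 1 + L * a := add_le_add (mul_le_mul ih hleg1 (norm_nonneg _) (by positivity)) hleg
      _ = ((i + 1 : ℕ) : ℝ) * (L * a) := by push_cast; ring

/-- **taxi frames of a regular bond field**: `‖taxiTv R x − 1‖ ≤ d·(L·a)`. [folklore] -/
theorem norm_taxiTv_sub_one_le (x : Tor (fine L N)) : ‖taxiTv L N R' x - 1‖ ≤ d * (L * a) :=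
  norm_taxiAcc_sub_one_le L N hR' ha0 ha _ _ d

end TaxiNear

/-! ## §2 The gap constant is monotone in its classes -/

section Monotone

/-- `revPC d n w ≤ revPC d 1 ω` for `n·w ≤ ω`, `0 ≤ w`. [folklore] -/
theorem revPC_le_of_class (n : ℕ) {w ω : ℝ} (hw0 : 0 ≤ w) (hω : (n : ℝ) * w ≤ ω) : revPC d n w ≤ revPC d 1 ω := by
  unfold revPC
  have h1 : (1 + (n : ℝ) * w) ^ 2 ≤ (1 + ((1 : ℕ) : ℝ) * ω) ^ 2 := by
    rw [Nat.cast_one, one_mul]; exact pow_le_pow_left₀ (by positivity) (by linarith) 2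
  exact mul_le_mul_of_nonneg_left h1 (by positivity)

/-- `gapE d n a ℓ w ≤ gapE d 1 α λ ω` for `na ≤ α`, `n²ℓ ≤ λ`, `nw ≤ ω` (all nonnegative). [folklore] -/
theorem gapE_le_of_class (n : ℕ) {a ℓ w α lam ω : ℝ} (ha0 : 0 ≤ a) (hℓ0 : 0 ≤ ℓ) (hw0 : 0 ≤ w) (hα : (n : ℝ) * a ≤ α) (hlam : (n : ℝ) ^ 2 * ℓ ≤ lam)
    (hω : (n : ℝ) * w ≤ ω) : gapE d n a ℓ w ≤ gapE d 1 α lam ω := by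
  have hR := revPC_le_of_class (d := d) n hw0 hω
  have hR0 := revPC_nonneg (d := d) n w
  have hna0 : 0 ≤ (n : ℝ) * a := by positivity
  have hnl0 : 0 ≤ (n : ℝ) ^ 2 * ℓ := by positivity
  have h2 : ((n : ℝ) * a) ^ 2 ≤ α ^ 2 := pow_le_pow_left₀ hna0 hα 2
  have h4 : ((n : ℝ) * a) ^ 4 ≤ α ^ 4 := pow_le_pow_left₀ hna0 hα 4
  have h3 : (((n : ℝ) * a) ^ 2 + (n : ℝ) ^ 2 * ℓ) ^ 2 ≤ (α ^ 2 + lam) ^ 2 := pow_le_pow_left₀ (by positivity) (by linarith) 2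
  unfold gapE
  rw [Nat.cast_one, one_mul, one_pow, one_mul]
  have hd : (0 : ℝ) ≤ d := Nat.cast_nonneg d
  have t1 : 12 * d * ((n : ℝ) * a) ^ 2 * revPC d n w ≤ 12 * d * α ^ 2 * revPC d 1 ω :=
    mul_le_mul (mul_le_mul_of_nonneg_left h2 (by positivity)) hR hR0 (by positivity)
  nlinarith [t1, mul_le_mul_of_nonneg_left h4 (show (0 : ℝ) ≤ 12 * (d : ℝ) ^ 2 by positivity),
    mul_le_mul_of_nonneg_left h3 (show (0 : ℝ) ≤ 3 * (d : ℝ) ^ 2 by positivity)]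

/-- **the gap constant is monotone in its classes**: `deltaGap d n a ℓ τ w ≤ deltaGap d 1 α λ τ⋆ ω`. [folklore] -/
theorem deltaGap_le_of_class (n : ℕ) {a ℓ τ w α lam τs ω : ℝ} (ha0 : 0 ≤ a) (hℓ0 : 0 ≤ ℓ) (hτ0 : 0 ≤ τ) (hw0 : 0 ≤ w) (hα : (n : ℝ) * a ≤ α)
    (hlam : (n : ℝ) ^ 2 * ℓ ≤ lam) (hτ : τ ≤ τs) (hω : (n : ℝ) * w ≤ ω) : deltaGap d n a ℓ τ w ≤ deltaGap d 1 α lam τs ω := by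
  have hR := revPC_le_of_class (d := d) n hw0 hω
  have hR0 := revPC_nonneg (d := d) n w
  have hG := gapE_le_of_class (d := d) n ha0 hℓ0 hw0 hα hlam hω
  unfold deltaGap
  have t1 : τ * revPC d n w ≤ τs * revPC d 1 ω := mul_le_mul hτ hR hR0 (hτ0.trans hτ)
  have t2 : Real.sqrt (gapE d n a ℓ w) ≤ Real.sqrt (gapE d 1 α lam ω) := Real.sqrt_le_sqrt hG
  linarith

end Monotone

/-! ## §3 Part 6's `hGdiv k` at one level, from a regular presentation of `Rlev k` -/

section Level

variable (L : ℕ) [NeZero L] (M : Fin d → ℕ) [hM : ∀ μ, NeZero (M μ)]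
variable {R' : (k : ℕ) → Tor (fine L (fine (L ^ k) M)) → Fin d → (ℂ →L[ℂ] ℂ)} (hL : 2 ≤ L)
  (hU : ∀ k x μ, R' k x μ ∈ unitary (ℂ →L[ℂ] ℂ)) {b : ℕ → ℝ} {c : ℝ}
  (hb : ∀ k x κ ι, ‖R' k x κ * R' k (x + unitVec (fine L (fine (L ^ k) M)) κ) ι - R' k x ι * R' k (x + unitVec (fine L (fine (L ^ k) M)) ι) κ‖ ≤ b k)
  (hbc : ∀ k, (((L ^ (k + 1) : ℕ)) : ℝ) ^ 2 * b k ≤ c)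
  (hcoh : ∀ k, coarseTv L (fine (L ^ (k + 1)) M) (R' (k + 1)) = Rtrv (L ^ k) L M (R' k))
include hL hU hb hbc hcoh

/-- **PART 6's DISPLAYED BINDER `hGdiv k`, SUPPLIED** at level `n = L^k` for `G k := projG (Rlev k) (ker Q_{taxiTv (Rlev k)})` and `Q := QvL (nestLv k)`, from a
regular presentation `(a, ℓ)` of `Rlev k` (`na ≤ α`, `n²ℓ ≤ λ`), its plaquette bound `p` (`n²p ≤ c`) and the numeric smallness in `(d, α, λ, c)`;
`C_D = 36C_f + 8`, `C_D′ = 24C_f + 4`, `C_f = d(d+1)Cst(d,1)`. [folklore] -/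
theorem hGdiv_projG_nestLv_regular (hd : 1 ≤ d) (hM2 : ∀ μ, 1 < M μ) (k : ℕ) {p : ℝ} (hp0 : 0 ≤ p)
    (hp : ∀ x κ ι, ‖Rlev L M R' k x κ * Rlev L M R' k (x + unitVec (fine (L ^ k) M) κ) ι - Rlev L M R' k x ι * Rlev L M R' k (x + unitVec (fine (L ^ k) M) ι) κ‖ ≤ p)
    (hpc : (((L ^ k : ℕ)) : ℝ) ^ 2 * p ≤ c)
    {a ℓ α lam : ℝ} (ha0 : 0 ≤ a) (ha : ∀ x μ, ‖Rlev L M R' k x μ - 1‖ ≤ a)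
    (hℓ : ∀ x μ, ‖Rlev L M R' k x μ - Rlev L M R' k (x - unitVec (fine (L ^ k) M) μ) μ‖ ≤ ℓ)
    (hα : (((L ^ k : ℕ)) : ℝ) * a ≤ α) (hlam : (((L ^ k : ℕ)) : ℝ) ^ 2 * ℓ ≤ lam)
    (hsmallδ : (18 * (d * ((d + 1 : ℝ) * Cst d 1)) + 6) * deltaGap d 1 α lam (d * α) (((d - 1 : ℕ) : ℝ) * c) ^ 2 ≤ 1 / 2)
    (hsmallQ : ((d + 1 : ℝ) * Cst d 1) * (7 * (d * α ^ 2) + 2 * (2 * ((((d - 1 : ℕ) : ℝ) + (d : ℝ) * d) * c) + (d * α + α)) ^ 2) ≤ 1 / 2)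
    (W : Tor (fine (L ^ k) M) → Fin d → ℂ) :
    ((((L ^ k : ℕ) : ℝ)) ^ d)⁻¹ * ((((L ^ k : ℕ) : ℝ)) ^ 2 * divSq (fine (L ^ k) M) (Rlev L M R' k) W)
      ≤ (36 * (d * ((d + 1 : ℝ) * Cst d 1)) + 8)
          * ScV (L ^ k) M (Rlev L M R' k) (projG (fine (L ^ k) M) (Rlev L M R' k) (LinearMap.ker (avgOp (L ^ k) M (taxiTv (L ^ k) M (Rlev L M R' k))))) W
        + (24 * (d * ((d + 1 : ℝ) * Cst d 1)) + 4) * nsqV M (QvL (L ^ k) M (nestLv L M R' k) W) := by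
  -- data facts at level `k`
  have hR' : ∀ k x μ, ‖R' k x μ‖ ≤ 1 := fun k x μ => norm_le_one_of_mem_unitary (hU k x μ)
  have hUk : ∀ x μ, Rlev L M R' k x μ ∈ unitary (ℂ →L[ℂ] ℂ) := Rlev_mem_unitary L M hU k
  have hRk : ∀ x μ, ‖Rlev L M R' k x μ‖ ≤ 1 := fun x μ => norm_le_one_of_mem_unitary (hUk x μ)
  have hT' : ∀ x, taxiTv (L ^ k) M (Rlev L M R' k) x ∈ unitary (ℂ →L[ℂ] ℂ) := taxiTv_mem_unitary (L ^ k) M hUk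
  have hT'1 : ∀ x, ‖taxiTv (L ^ k) M (Rlev L M R' k) x‖ ≤ 1 := fun x => norm_le_one_of_mem_unitary (hT' x)
  have hn0 : (0 : ℝ) ≤ ((L ^ k : ℕ) : ℝ) := Nat.cast_nonneg _
  have hd0 : (0 : ℝ) ≤ d := Nat.cast_nonneg d
  have hℓ0 : 0 ≤ ℓ := (norm_nonneg _).trans (hℓ 0 ⟨0, hd⟩)
  have hα0 : 0 ≤ α := le_trans (by positivity) hα
  have hb0 : ∀ q, 0 ≤ b q := fun q => (norm_nonneg _).trans (hb q 0 ⟨0, hd⟩ ⟨0, hd⟩)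
  have hc0 : 0 ≤ c := le_trans (by positivity) hpc
  -- the frame field: `‖taxiTv − 1‖ ≤ τ := d·(n·a)` and the in-block mismatch `w := (d−1)(n−1)p`
  have hτ : ∀ x, ‖taxiTv (L ^ k) M (Rlev L M R' k) x - 1‖ ≤ d * ((((L ^ k : ℕ)) : ℝ) * a) :=
    fun x => norm_taxiTv_sub_one_le (L ^ k) M hRk ha0 ha x
  have hw := inBlock_blockOf_of_bpt (L ^ k) M hM2
    (P := fun x μ => ‖Rlev L M R' k x μ * star (taxiTv (L ^ k) M (Rlev L M R' k) (x + unitVec (fine (L ^ k) M) μ)) * taxiTv (L ^ k) M (Rlev L M R' k) x - 1‖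
      ≤ ((d - 1 : ℕ) : ℝ) * ((L ^ k - 1 : ℕ) : ℝ) * p)
    (fun y j μ hj => inBlock_defect_taxiTv_adjoint_le (L ^ k) M hUk hp y j μ hj)
  have hw0 : 0 ≤ ((d - 1 : ℕ) : ℝ) * ((L ^ k - 1 : ℕ) : ℝ) * p := by positivity
  -- the one-sided slice closeness for these covariant frames, and its class bound
  have hclose := sliceFlat_close_covariant (E := ℂ) (L ^ k) M hT' hτ hUk ha hℓ hw0 hw
  have hnw : (((L ^ k : ℕ)) : ℝ) * (((d - 1 : ℕ) : ℝ) * ((L ^ k - 1 : ℕ) : ℝ) * p) ≤ ((d - 1 : ℕ) : ℝ) * c := blockDefect_le_of_class L k hp0 hpc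
  have hδle : deltaGap d (L ^ k) a ℓ (d * ((((L ^ k : ℕ)) : ℝ) * a)) (((d - 1 : ℕ) : ℝ) * ((L ^ k - 1 : ℕ) : ℝ) * p)
      ≤ deltaGap d 1 α lam (d * α) (((d - 1 : ℕ) : ℝ) * c) := by
    refine deltaGap_le_of_class (d := d) (L ^ k) ha0 hℓ0 (by positivity) hw0 ?_ ?_ (mul_le_mul_of_nonneg_left hα hd0) ?_
    · simpa only [Nat.cast_pow] using hα
    · simpa only [Nat.cast_pow] using hlam
    · simpa only [Nat.cast_pow] using hnw
  have hδ0 : 0 ≤ deltaGap d (L ^ k) a ℓ (d * ((((L ^ k : ℕ)) : ℝ) * a)) (((d - 1 : ℕ) : ℝ) * ((L ^ k - 1 : ℕ) : ℝ) * p) :=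
    deltaGap_nonneg (d := d) (L ^ k) (by positivity)
  have hsmallδk : (18 * (d * ((d + 1 : ℝ) * Cst d 1)) + 6)
      * deltaGap d (L ^ k) a ℓ (d * ((((L ^ k : ℕ)) : ℝ) * a)) (((d - 1 : ℕ) : ℝ) * ((L ^ k - 1 : ℕ) : ℝ) * p) ^ 2 ≤ 1 / 2 := by
    have hC0 : 0 ≤ 18 * (d * ((d + 1 : ℝ) * Cst d 1)) + 6 := by
      have := Literature.MathematicalPhysics.QuantumFieldTheory.Balaban1983to89.B5Prop11Lower.one_le_Cst (d := d) (1 : ℝ); positivity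
    have hsq := pow_le_pow_left₀ hδ0 hδle 2
    exact (mul_le_mul_of_nonneg_left hsq hC0).trans hsmallδ
  -- the nested carriers against the flat line average: `‖nestLv − 1‖ ≤ γ + (τ + n·a)`
  set γ : ℝ := ∑ q ∈ Finset.range k, ((((d - 1 : ℕ) : ℝ) + (d : ℝ) * d) * (((L : ℝ) * ((L ^ q - 1 : ℕ) : ℝ) * ((L - 1 : ℕ) : ℝ)) * b q)) with hγ
  have hγ0 : 0 ≤ γ := by
    rw [hγ]; refine sum_nonneg fun q _ => ?_; have := hb0 q; positivity
  have hγs : γ ≤ 2 * ((((d - 1 : ℕ) : ℝ) + (d : ℝ) * d) * c) := sumDefect_le_of_class (d := d) L hL hb0 hbc k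
  have hnear : ∀ (y : Tor M) (j : Fin d → Fin (L ^ k)) (t : Fin (L ^ k)) (μ : Fin d),
      ‖nestLv L M R' k y j t μ - 1‖ ≤ γ + (d * ((((L ^ k : ℕ)) : ℝ) * a) + (((L ^ k : ℕ)) : ℝ) * a) := by
    intro y j t μ
    have h1 := nestLv_sub_lineT_le L M hR' hb hcoh k y j t μ
    have h2 := norm_lineT_sub_one_le (L ^ k) M hT'1 hτ hRk ha0 ha y j t μ
    calc ‖nestLv L M R' k y j t μ - 1‖
        = ‖(nestLv L M R' k y j t μ - lineT (L ^ k) M (taxiTv (L ^ k) M (Rlev L M R' k)) (Rlev L M R' k) y j t μ)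
            + (lineT (L ^ k) M (taxiTv (L ^ k) M (Rlev L M R' k)) (Rlev L M R' k) y j t μ - 1)‖ := by rw [sub_add_sub_cancel]
      _ ≤ _ := norm_add_le _ _
      _ ≤ γ + (d * ((((L ^ k : ℕ)) : ℝ) * a) + (((L ^ k : ℕ)) : ℝ) * a) := by
          refine add_le_add (by simpa only [hγ] using h1) ?_
          simpa only [Nat.cast_pow] using h2
  have hβ0 : 0 ≤ γ + (d * ((((L ^ k : ℕ)) : ℝ) * a) + (((L ^ k : ℕ)) : ℝ) * a) := by positivity
  have hQ := nsqV_QvL_flat_le_of_near (L ^ k) M hβ0 hnear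
  -- the `Q`-smallness at this level from the class form
  have hsmallQk : ((d + 1 : ℝ) * Cst d 1) * (7 * (d * ((((L ^ k : ℕ) : ℝ)) * a) ^ 2)
      + 2 * (γ + (d * ((((L ^ k : ℕ)) : ℝ) * a) + (((L ^ k : ℕ)) : ℝ) * a)) ^ 2) ≤ 1 / 2 := by
    have hCB0 : 0 ≤ (d + 1 : ℝ) * Cst d 1 := by
      have := Literature.MathematicalPhysics.QuantumFieldTheory.Balaban1983to89.B5Prop11Lower.one_le_Cst (d := d) (1 : ℝ); positivity
    have hna : (((L ^ k : ℕ)) : ℝ) * a ≤ α := hα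
    have h1 : ((((L ^ k : ℕ) : ℝ)) * a) ^ 2 ≤ α ^ 2 := pow_le_pow_left₀ (by positivity) hna 2
    have h2 : (γ + (d * ((((L ^ k : ℕ)) : ℝ) * a) + (((L ^ k : ℕ)) : ℝ) * a)) ^ 2
        ≤ (2 * ((((d - 1 : ℕ) : ℝ) + (d : ℝ) * d) * c) + (d * α + α)) ^ 2 :=
      pow_le_pow_left₀ hβ0 (by nlinarith [hγs, hna, mul_le_mul_of_nonneg_left hna hd0]) 2
    have h3 : 7 * (d * ((((L ^ k : ℕ) : ℝ)) * a) ^ 2) + 2 * (γ + (d * ((((L ^ k : ℕ)) : ℝ) * a) + (((L ^ k : ℕ)) : ℝ) * a)) ^ 2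
        ≤ 7 * (d * α ^ 2) + 2 * (2 * ((((d - 1 : ℕ) : ℝ) + (d : ℝ) * d) * c) + (d * α + α)) ^ 2 := by
      nlinarith [mul_le_mul_of_nonneg_left h1 hd0, h2]
    exact (mul_le_mul_of_nonneg_left h3 hCB0).trans hsmallQ
  -- assemble
  have h := divControl_of_sliceClose (L ^ k) M ha (LinearMap.ker (avgOp (L ^ k) M (taxiTv (L ^ k) M (Rlev L M R' k)))) hδ0 hclose
    (by positivity : (0 : ℝ) ≤ 2 * (γ + (d * ((((L ^ k : ℕ)) : ℝ) * a) + (((L ^ k : ℕ)) : ℝ) * a)) ^ 2) hQ hsmallδk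
    (by simpa only [mul_pow] using hsmallQk) W
  simpa only [Nat.cast_pow] using h

end Level

/-! ## §4 THE END: existence of the vector tower limit at Bałaban's taxi data for Bałaban's covariant projected functional ⇐ (ONE-min) + a regular presentation -/

section End

variable (L : ℕ) [NeZero L] (M : Fin d → ℕ) [hM : ∀ μ, NeZero (M μ)]
variable {R' : (k : ℕ) → Tor (fine L (fine (L ^ k) M)) → Fin d → (ℂ →L[ℂ] ℂ)} (hL : 2 ≤ L)
  (hU : ∀ k x μ, R' k x μ ∈ unitary (ℂ →L[ℂ] ℂ)) {b : ℕ → ℝ} {c : ℝ}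
  (hb : ∀ k x κ ι, ‖R' k x κ * R' k (x + unitVec (fine L (fine (L ^ k) M)) κ) ι - R' k x ι * R' k (x + unitVec (fine L (fine (L ^ k) M)) ι) κ‖ ≤ b k)
  (hbc : ∀ k, (((L ^ (k + 1) : ℕ)) : ℝ) ^ 2 * b k ≤ c)
  (hcoh : ∀ k, coarseTv L (fine (L ^ (k + 1)) M) (R' (k + 1)) = Rtrv (L ^ k) L M (R' k))
include hL hU hb hbc hcoh

/-- **EXISTENCE OF THE VECTOR TOWER LIMIT AT BAŁABAN's TAXI DATA FOR BAŁABAN's COVARIANT PROJECTED GAUGE FUNCTIONAL ⇐ (ONE-min) + A REGULAR PRESENTATION.**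
Part 6's `effV_tendsto_taxiTower_projG_of_class` (p229644) with its DISPLAYED coercivity binder (GF3)_k SUPPLIED at every level by §3 (`C_D⋆ = 36C_f + 8`,
`C_D′⋆ = 24C_f + 4`): the one-step bond data (unitary, plaquette class `(L^{k+1})²b_k ≤ c`, coherent) and its polynomial smallness `hsm1–hsm4` as in part 6;
NEW displayed DATA classes: a regular presentation `‖Rlev k − 1‖ ≤ a_k`, `‖Rlev k(x,μ) − Rlev k(x−e_μ,μ)‖ ≤ ℓ_k` with `L^k·a_k ≤ α`, `(L^k)²·ℓ_k ≤ λ`, and the two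
numeric lines `(18C_f + 6)·(deltaGap d 1 α λ (dα) ((d−1)c))² ≤ ½`, `C_B·(7dα² + 2(2((d−1)+d²)c + (d+1)α)²) ≤ ½`; the ONE displayed analytic leaf is (ONE-min)_k.
Conclusion verbatim part 6's. [folklore] -/
theorem effV_tendsto_taxiTower_projG_regular_of_class (hd : 1 ≤ d) (hM2 : ∀ μ, 1 < M μ)
    -- the polynomial smallness of the class constant
    (hsm1 : 60 * (6 : ℝ) ^ (d - 1) * ((2 * ((((d - 1 : ℕ) : ℝ) + (d : ℝ) * d)) + 3 * ((d - 1 : ℕ) : ℝ)) * c) ≤ 1 / 2)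
    (hsm2 : 2 * (d : ℝ) * ((((d - 1 : ℕ) : ℝ)) * c) ^ 2 ≤ 1 / 2) (hsm3 : 64 * (2 * ((((d - 1 : ℕ) : ℝ) + (d : ℝ) * d) * c)) ^ 2 ≤ 1)
    (hsm4 : 80 * ((d : ℝ) * c) ≤ 1)
    -- the DISPLAYED regular presentation of the tower's unit-lattice bond fields and the numeric smallness replacing (GF3)
    {ar ℓr : ℕ → ℝ} {α lam : ℝ} (har0 : ∀ k, 0 ≤ ar k) (har : ∀ k x μ, ‖Rlev L M R' k x μ - 1‖ ≤ ar k)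
    (hℓr : ∀ k x μ, ‖Rlev L M R' k x μ - Rlev L M R' k (x - unitVec (fine (L ^ k) M) μ) μ‖ ≤ ℓr k)
    (hα : ∀ k, (((L ^ k : ℕ)) : ℝ) * ar k ≤ α) (hlam : ∀ k, (((L ^ k : ℕ)) : ℝ) ^ 2 * ℓr k ≤ lam)
    (hsmallδ : (18 * (d * ((d + 1 : ℝ) * Cst d 1)) + 6) * deltaGap d 1 α lam (d * α) (((d - 1 : ℕ) : ℝ) * c) ^ 2 ≤ 1 / 2)
    (hsmallQ : ((d + 1 : ℝ) * Cst d 1) * (7 * (d * α ^ 2) + 2 * (2 * ((((d - 1 : ℕ) : ℝ) + (d : ℝ) * d) * c) + (d * α + α)) ^ 2) ≤ 1 / 2)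
    -- the effective-operator parameter, the decay rate and the DISPLAYED leaf (ONE-min)
    {aa : ℝ} (haa : 0 < aa) {θ : ℝ} (hθ : 0 ≤ θ) (hθ1 : θ < 1)
    (ε₁ δ' : ℕ → ℝ) {cε cδ' : ℝ} (hε₁ : ∀ k, 0 ≤ ε₁ k) (hδ' : ∀ k, 0 ≤ δ' k) (hεθ : ∀ k, ε₁ k ≤ cε * θ ^ k) (hδ'θ : ∀ k, δ' k ≤ cδ' * θ ^ k)
    (hONEm : ∀ k (φ : Tor M → Fin d → ℂ) (W₀ : Tor (fine (L ^ k) M) → Fin d → ℂ), QvL (L ^ k) M (nestLv L M R' k) W₀ = φ →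
      (∀ W, QvL (L ^ k) M (nestLv L M R' k) W = φ →
        ScV (L ^ k) M (Rlev L M R' k) (projG (fine (L ^ k) M) (Rlev L M R' k) (LinearMap.ker (avgOp (L ^ k) M (taxiTv (L ^ k) M (Rlev L M R' k))))) W₀
          ≤ ScV (L ^ k) M (Rlev L M R' k) (projG (fine (L ^ k) M) (Rlev L M R' k) (LinearMap.ker (avgOp (L ^ k) M (taxiTv (L ^ k) M (Rlev L M R' k))))) W) →
      ∃ g, QvL (L ^ k) M (nestLv L M R' k) (QvL L (fine (L ^ k) M) (lineT L (fine (L ^ k) M) (taxiTv L (fine (L ^ k) M) (R' k)) (R' k)) g) = φ ∧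
        SfV (L ^ k) L M (R' k)
            (fun W' => projG (fine (L ^ (k + 1)) M) (Rlev L M R' (k + 1)) (LinearMap.ker (avgOp (L ^ (k + 1)) M (taxiTv (L ^ (k + 1)) M (Rlev L M R' (k + 1)))))
              (W' ∘ Literature.MathematicalPhysics.QuantumFieldTheory.Balaban1983to89.B5Composition116.sites (L ^ k) L M)) g
          ≤ (Real.sqrt (ScV (L ^ k) M (Rlev L M R' k) (projG (fine (L ^ k) M) (Rlev L M R' k) (LinearMap.ker (avgOp (L ^ k) M (taxiTv (L ^ k) M (Rlev L M R' k))))) W₀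
                + ε₁ k * rhoV (L ^ k) M (Rlev L M R' k) W₀)
              + δ' k * Real.sqrt (qWV (L ^ k) M W₀)) ^ 2) :
    ∃ Xlim : Matrix (Tor M × Fin d) (Tor M × Fin d) ℂ,
      Tendsto (fun k => effV (L ^ k) M (Rlev L M R' k)
        (GmProj (fine (L ^ k) M) (Rlev L M R' k) (LinearMap.ker (avgOp (L ^ k) M (taxiTv (L ^ k) M (Rlev L M R' k))))) (QmL (L ^ k) M (nestLv L M R' k)) aa)
        atTop (𝓝 Xlim) ∧ Xlim.IsHermitian ∧ (∀ v, 0 ≤ qform Xlim v) ∧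
      ∀ φ : Tor M → Fin d → ℂ, Tendsto (fun k => blockSpin (QvL (L ^ k) M (nestLv L M R' k))
        (ScV (L ^ k) M (Rlev L M R' k) (projG (fine (L ^ k) M) (Rlev L M R' k) (LinearMap.ker (avgOp (L ^ k) M (taxiTv (L ^ k) M (Rlev L M R' k)))))) φ)
        atTop (𝓝 (qform Xlim (unc φ))) := by

  have hCf0 : 0 ≤ (36 * (d * ((d + 1 : ℝ) * Cst d 1)) + 8 : ℝ) := by
    have := Literature.MathematicalPhysics.QuantumFieldTheory.Balaban1983to89.B5Prop11Lower.one_le_Cst (d := d) (1 : ℝ); positivity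
  have hCf0' : 0 ≤ (24 * (d * ((d + 1 : ℝ) * Cst d 1)) + 4 : ℝ) := by
    have := Literature.MathematicalPhysics.QuantumFieldTheory.Balaban1983to89.B5Prop11Lower.one_le_Cst (d := d) (1 : ℝ); positivity
  -- the plaquette bounds of the unit-lattice bond fields along the tower (the class package with trivial (GF1′) constants)
  obtain ⟨p, hp0, hp, hpc, -, -, -, -, -⟩ := taxiClassPackage L M hL hd hU hb hbc hsm1 hsm2 hsm3 (CG := fun _ => (d : ℝ)) (C₀ := fun _ => 0)
    (CGs := (d : ℝ)) (c₀ := 0) (fun _ => Nat.cast_nonneg d) (fun _ => le_rfl) (fun _ => le_rfl) (fun _ => by simp)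
  exact effV_tendsto_taxiTower_projG_of_class L M hL hd hM2 hU hb hbc hcoh hsm1 hsm2 hsm3 hsm4
    (CD := fun _ => 36 * (d * ((d + 1 : ℝ) * Cst d 1)) + 8) (CD' := fun _ => 24 * (d * ((d + 1 : ℝ) * Cst d 1)) + 4)
    (CDs := 36 * (d * ((d + 1 : ℝ) * Cst d 1)) + 8) (CDs' := 24 * (d * ((d + 1 : ℝ) * Cst d 1)) + 4)
    (fun _ => hCf0) (fun _ => le_rfl) (fun _ => hCf0') (fun _ => le_rfl)
    (fun k W => hGdiv_projG_nestLv_regular L M hL hU hb hbc hcoh hd hM2 k (hp0 k) (hp k) (hpc k) (har0 k) (har k) (hℓr k) (hα k) (hlam k) hsmallδ hsmallQ W)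
    haa hθ hθ1 ε₁ δ' hε₁ hδ' hεθ hδ'θ hONEm

end End

end Summit.QuantumFields.BalabanUV.T4Continuum.VariationalColourTaxiTransport

end
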